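import Summits.QuantumFields.YangMills.Theorems.BalabanUVNodesPortHRecordJoinWith
import Summits.QuantumFields.YangMills.Theorems.BalabanUVNodesK0RecordFormatNamesLocC

/-!
# PORT helper (PT-H ∕ K0ᴬ JOIN lineage; INTENT-16) — THE JOIN INSTANCE AT ◆ CRIT-1's v11-G₄ (ρ-tok) TEXT of stmt-QuantumFields-27931 (bca3cb0d9af367ce · 15 736 ch, ★★★ №498):
# `joinGoalL11G4_of_texts (F) : Sig8LR4 F → Sig7V11G4 F → JoinGoalL11G4 F` = the tree certificate `joinGoalWith_of_texts_conj TokRest4` (✓ `…PortHRecordJoinWith`) at the G₄ token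
# — LOCAL verbatim texts, route file NOT imported (docket O-8)

AUTHORSHIP ∕ CREDIT.  ◇ LENS-1 (planner seat `ymgap-nodeO-lens-1` g5): this module is lines :129–:180 of lens-1's farm-checked tree twin `pub/ym-nodeO-ideate/nodeO-cover/LENS-1-RecordJoinG4-tree-v1.lean`
(dff20cec68fe4510 · 184 l.; its :41–:127 = the token-parametric §20, landed separately as ✓`…PortHRecordJoinWithDefs` ∕ ✓`…PortHRecordJoinWith` in the same per-family arity, so the proofs
below are lens-1's VERBATIM), landed by porter PTC-1 g3 (`ymgap-nodeO-port-PTC-1`) keyed `--supports stmt-QuantumFields-27238 --as helper` (no `--workitem`, R615) AFTER ◆ CRIT-1's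
`set-signature` read-back of the G₄ bytes.  TEXT PROVENANCE: `Tok182` (f55bbcaced52e485 · 988 ch), `TokCmpUcap` (45b42288063bae23 · 5 180 ch), `TokRest4` (8dc4c605d32b334e · 6 175 ch),
`Sig7V11G4 F` (bca3cb0d9af367ce · 15 736 ch after the family binder) = ◆ CRIT-1 g34's files `nodeO-cover/CRIT-1-{Tok182-v1,TokCmpUcap-v4,TokRest-v4,Sig27931-v11G4-conj}.txt` VERBATIM.
[I] = [Balaban1987RG1], [15] = [Balaban1985Variational].

HONEST FRAMING.  Hypothesis-shaped TEXTS and implications between them; every displayed row is the consequent of an OPEN signed statement item (27930 ⁸ 12934e3fd231d69a; 27931 ⁷,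
sixth text v11-G₄ bca3cb0d9af367ce) or a tree receipt; Tok-182's truth is [15] (182) at B = 0 AT THE NAMES — asserted by nobody; nothing of [I] (Thm 1, (1.19)–(1.22), (4.33)–(4.37),
(5.10)) or [15] (Thm 1, Prop. 9, (182), (190)) is asserted, ported, discharged or refuted; TokP9-reg NOT proved; K-Ax 27238∕27239∕27247 OPEN; K0⁷∕K0ᴬ OPEN; NODE O 0∕1; COUNT 8∕28 · K 1∕4
UNMOVED; ONE finite `𝕋⁴_{L^K}` at fixed ε — NOT continuum ∕ OS ∕ Clay; **the Yang–Mills mass gap (Clay) is NOT proved by any of this.**  No `sorry`, no `instance`, no `notation`; standard axioms.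
-/

noncomputable section

open scoped BigOperators Matrix.Norms.L2Operator Topology
open Set Filter

namespace Summit.QuantumFields.YangMills.Theorems.PortHRecordJoin

open Summit.QuantumFields.YangMills.Theorems.K0RecordFormatNames
open Summit.QuantumFields.YangMills.Theorems
open Literature.MathematicalPhysics.QuantumFieldTheory.Balaban1983to89
open Literature.MathematicalPhysics.QuantumFieldTheory.Balaban1983to89.Node00
open Literature.MathematicalPhysics.QuantumFieldTheory.Balaban1983to89.T4Continuum (T4Family)

/-! ## THE INSTANCE AT ◆ CRIT-1's v11-G₄ (ρ-tok) TEXT (★★★ №498: THE text of stmt-QuantumFields-27931 to sign; lens-1 JOIN v5.6 §23) -/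

/-- ◆ CRIT-1's **Tok-182** bytes VERBATIM (f55bbcaced52e485 · 988 ch): the identification `recordHr = recordHrLocξ univ` at the fill, DISPLAYED BY NAME — [15] (182)∕(184) at B = 0.
Hypothesis-shaped; asserted by nobody. [cite: Balaban1985Variational, (182) p.307, (184) p.307, Prop. 9 p.309] -/
def Tok182 (F : T4Family) (Mc : ℕ) (a₀ : ℝ) : Prop :=
  ∀ (k n : ℕ) (ε₂₉ : ℝ), 0 < ε₂₉ → letI θ := Summit.QuantumFields.YangMills.Theorems.K0RecordFormatNames.thetaFill F a₀ ε₂₉; letI := θ.instVβ₁; letI := θ.instVβ₂; letI := θ.instιβ; ∀ (a : θ.ιβ) (μ : Fin (F.P (Summit.QuantumFields.YangMills.Theorems.K0RecordFormatNames.recordK₀ F Mc k + n)).d) (y : Literature.MathematicalPhysics.QuantumFieldTheory.Balaban1983to89.Site (F.P (Summit.QuantumFields.YangMills.Theorems.K0RecordFormatNames.recordK₀ F Mc k + n)) (k + 1)), ∀ b : Literature.MathematicalPhysics.QuantumFieldTheory.Balaban1983to89.PBond (F.P (Summit.QuantumFields.YangMills.Theorems.K0RecordFormatNames.recordK₀ F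 Mc k + n)) 0, Summit.QuantumFields.YangMills.Theorems.K0RecordFormatNames.recordHr F θ k (Summit.QuantumFields.YangMills.Theorems.K0RecordFormatNames.recordK₀ F Mc k + n) a (μ, y) b = Summit.QuantumFields.YangMills.Theorems.K0RecordFormatNames.recordHrLocξ F θ k (Summit.QuantumFields.YangMills.Theorems.K0RecordFormatNames.recordK₀ F Mc k + n) Finset.univ a (μ, y) b

/-- ◆ CRIT-1's **Tok-cmpU-cap** bytes VERBATIM (45b42288063bae23 · 5 180 ch): single-chain window-vs-whole-torus comparison of `recordHrLocξ` at nested radii `R3 + nestRadius Mc 1 ≤ R0` under the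
centre-free cap `2 * (R0 + 1) < sitesPerDir (k+1)` — [I] p.290 L17–20's own pairing.  Hypothesis-shaped; nothing asserted. [cite: Balaban1987RG1, (4.35) p.290, (3.37) p.277] -/
def TokCmpUcap (F : T4Family) (Mc : ℕ) (a₀ : ℝ) : Prop :=
  (∃ C₉' δ₉ : ℝ, 0 ≤ C₉' ∧ 0 < δ₉ ∧ ∀ (k n : ℕ) (ε₂₉ : ℝ), 0 < ε₂₉ → letI θ := Summit.QuantumFields.YangMills.Theorems.K0RecordFormatNames.thetaFill F a₀ ε₂₉; letI := θ.instVβ₁; letI := θ.instVβ₂; letI := θ.instιβ; ∀ (a : θ.ιβ) (μ : Fin (F.P (Summit.QuantumFields.YangMills.Theorems.K0RecordFormatNames.recordK₀ F Mc k + n)).d) (y : Literature.MathematicalPhysics.QuantumFieldTheory.Balaban1983to89.Site (F.P (Summit.QuantumFields.YangMills.Theorems.K0RecordFormatNames.recordK₀ F Mc k + n)) (k + 1)), ∀ R3 R0 : ℕ, R3 + Summit.QuantumFields.YangMills.Theorems.K0RecordFormatNames.nestRadius Mc 1 ≤ R0 → 2 * (R0 + 1) < (F.P (Summit.QuantumFields.YangMills.Theorems.K0RecordFormatNames.recordK₀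 F Mc k + n)).sitesPerDir (k + 1) → ∀ z₀ : Fin 4 → ℤ, y ∈ Summit.QuantumFields.YangMills.Theorems.K0RecordFormatNames.recordWindow F k (Summit.QuantumFields.YangMills.Theorems.K0RecordFormatNames.recordK₀ F Mc k + n) R3 z₀ → letI Hd : Literature.MathematicalPhysics.QuantumFieldTheory.Balaban1983to89.PBond (F.P (Summit.QuantumFields.YangMills.Theorems.K0RecordFormatNames.recordK₀ F Mc k + n)) 0 → Fin 2 → Fin 2 → ℂ := fun b' => Summit.QuantumFields.YangMills.Theorems.K0RecordFormatNames.recordHrLocξ F θ k (Summit.QuantumFields.YangMills.Theorems.K0RecordFormatNames.recordK₀ F Mc k + n) Finset.univ a (μ, y) b' - Summit.QuantumFields.YangMills.Theorems.K0RecordFormatNames.recordHrLocξ F θ k (Summit.QuantumFields.YangMills.Theorems.K0RecordFormatNames.recordK₀ F Mc k + n) (Summit.QuantumFields.YangMills.Theorems.K0RecordFormatNames.recordWindow F k (Summit.QuantumFields.YangMills.Theorems.K0RecordFormatNames.recordK₀ F Mc k + n) R0 z₀) a (μ, y) b'; ∀ b : Literature.MathematicalPhysics.QuantumFieldTheory.Balaban1983to89.PBond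 (F.P (Summit.QuantumFields.YangMills.Theorems.K0RecordFormatNames.recordK₀ F Mc k + n)) 0, Summit.QuantumFields.YangMills.Theorems.K0RecordFormatNames.coarsenTo (k + 1) b.src ∈ Summit.QuantumFields.YangMills.Theorems.K0RecordFormatNames.recordWindow F k (Summit.QuantumFields.YangMills.Theorems.K0RecordFormatNames.recordK₀ F Mc k + n) R3 z₀ → ‖Hd b‖ ≤ C₉' * (F.P (Summit.QuantumFields.YangMills.Theorems.K0RecordFormatNames.recordK₀ F Mc k + n)).eta (k + 1) * Real.exp (-(δ₉ * ((R0 : ℝ) - (R3 : ℝ)))) ∧ (∀ ν : Fin (F.P (Summit.QuantumFields.YangMills.Theorems.K0RecordFormatNames.recordK₀ F Mc k + n)).d, ‖Hd (⟨b.src.shift ν, b.dir⟩ : Literature.MathematicalPhysics.QuantumFieldTheory.Balaban1983to89.PBond (F.P (Summit.QuantumFields.YangMills.Theorems.K0RecordFormatNames.recordK₀ F Mc k + n)) 0) - Hd b‖ ≤ C₉' * (F.P (Summit.QuantumFields.YangMills.Theorems.K0RecordFormatNames.recordK₀ F Mc k + n)).eta (k + 1) ^ 2 * Real.exp (-(δ₉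 * ((R0 : ℝ) - (R3 : ℝ))))) ∧ ‖∑ ν : Fin (F.P (Summit.QuantumFields.YangMills.Theorems.K0RecordFormatNames.recordK₀ F Mc k + n)).d, (Hd (⟨b.src.shift ν, b.dir⟩ : Literature.MathematicalPhysics.QuantumFieldTheory.Balaban1983to89.PBond (F.P (Summit.QuantumFields.YangMills.Theorems.K0RecordFormatNames.recordK₀ F Mc k + n)) 0) - (2 : ℂ) • Hd b + Hd (⟨b.src.unshift ν, b.dir⟩ : Literature.MathematicalPhysics.QuantumFieldTheory.Balaban1983to89.PBond (F.P (Summit.QuantumFields.YangMills.Theorems.K0RecordFormatNames.recordK₀ F Mc k + n)) 0))‖ ≤ C₉' * (F.P (Summit.QuantumFields.YangMills.Theorems.K0RecordFormatNames.recordK₀ F Mc k + n)).eta (k + 1) ^ 3 * Real.exp (-(δ₉ * ((R0 : ℝ) - (R3 : ℝ)))) ∧ ‖∑ ν : Fin (F.P (Summit.QuantumFields.YangMills.Theorems.K0RecordFormatNames.recordK₀ F Mc k + n)).d, ((Hd (⟨b.src, b.dir⟩ : Literature.MathematicalPhysics.QuantumFieldTheory.Balaban1983to89.PBond (F.P (Summit.QuantumFields.YangMills.Theorems.K0RecordFormatNames.recordK₀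 F Mc k + n)) 0) + Hd (⟨(b.src).shift b.dir, ν⟩ : Literature.MathematicalPhysics.QuantumFieldTheory.Balaban1983to89.PBond (F.P (Summit.QuantumFields.YangMills.Theorems.K0RecordFormatNames.recordK₀ F Mc k + n)) 0) - Hd (⟨(b.src).shift ν, b.dir⟩ : Literature.MathematicalPhysics.QuantumFieldTheory.Balaban1983to89.PBond (F.P (Summit.QuantumFields.YangMills.Theorems.K0RecordFormatNames.recordK₀ F Mc k + n)) 0) - Hd (⟨b.src, ν⟩ : Literature.MathematicalPhysics.QuantumFieldTheory.Balaban1983to89.PBond (F.P (Summit.QuantumFields.YangMills.Theorems.K0RecordFormatNames.recordK₀ F Mc k + n)) 0)) - (Hd (⟨b.src.unshift ν, b.dir⟩ : Literature.MathematicalPhysics.QuantumFieldTheory.Balaban1983to89.PBond (F.P (Summit.QuantumFields.YangMills.Theorems.K0RecordFormatNames.recordK₀ F Mc k + n)) 0) + Hd (⟨(b.src.unshift ν).shift b.dir, ν⟩ : Literature.MathematicalPhysics.QuantumFieldTheory.Balaban1983to89.PBond (F.P (Summit.QuantumFields.YangMills.Theorems.K0RecordFormatNames.recordK₀ F Mc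 k + n)) 0) - Hd (⟨(b.src.unshift ν).shift ν, b.dir⟩ : Literature.MathematicalPhysics.QuantumFieldTheory.Balaban1983to89.PBond (F.P (Summit.QuantumFields.YangMills.Theorems.K0RecordFormatNames.recordK₀ F Mc k + n)) 0) - Hd (⟨b.src.unshift ν, ν⟩ : Literature.MathematicalPhysics.QuantumFieldTheory.Balaban1983to89.PBond (F.P (Summit.QuantumFields.YangMills.Theorems.K0RecordFormatNames.recordK₀ F Mc k + n)) 0)))‖ ≤ C₉' * (F.P (Summit.QuantumFields.YangMills.Theorems.K0RecordFormatNames.recordK₀ F Mc k + n)).eta (k + 1) ^ 3 * Real.exp (-(δ₉ * ((R0 : ℝ) - (R3 : ℝ)))))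

/-- ◆ CRIT-1's **TokRest-v4** bytes VERBATIM (8dc4c605d32b334e · 6 175 ch) = `(Tok-182) ∧ (Tok-cmpU-cap)`. Hypothesis-shaped; nothing asserted.
[cite: Balaban1985Variational, (182) p.307; Balaban1987RG1, (4.35) p.290] -/
def TokRest4 (F : T4Family) (Mc : ℕ) (a₀ : ℝ) : Prop :=
  (∀ (k n : ℕ) (ε₂₉ : ℝ), 0 < ε₂₉ → letI θ := Summit.QuantumFields.YangMills.Theorems.K0RecordFormatNames.thetaFill F a₀ ε₂₉; letI := θ.instVβ₁; letI := θ.instVβ₂; letI := θ.instιβ; ∀ (a : θ.ιβ) (μ : Fin (F.P (Summit.QuantumFields.YangMills.Theorems.K0RecordFormatNames.recordK₀ F Mc k + n)).d) (y : Literature.MathematicalPhysics.QuantumFieldTheory.Balaban1983to89.Site (F.P (Summit.QuantumFields.YangMills.Theorems.K0RecordFormatNames.recordK₀ F Mc k + n)) (k + 1)), ∀ b : Literature.MathematicalPhysics.QuantumFieldTheory.Balaban1983to89.PBond (F.P (Summit.QuantumFields.YangMills.Theorems.K0RecordFormatNames.recordK₀ F Mc k + n)) 0, Summit.QuantumFields.YangMills.Theorems.K0RecordFormatNames.recordHr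 F θ k (Summit.QuantumFields.YangMills.Theorems.K0RecordFormatNames.recordK₀ F Mc k + n) a (μ, y) b = Summit.QuantumFields.YangMills.Theorems.K0RecordFormatNames.recordHrLocξ F θ k (Summit.QuantumFields.YangMills.Theorems.K0RecordFormatNames.recordK₀ F Mc k + n) Finset.univ a (μ, y) b) ∧ ((∃ C₉' δ₉ : ℝ, 0 ≤ C₉' ∧ 0 < δ₉ ∧ ∀ (k n : ℕ) (ε₂₉ : ℝ), 0 < ε₂₉ → letI θ := Summit.QuantumFields.YangMills.Theorems.K0RecordFormatNames.thetaFill F a₀ ε₂₉; letI := θ.instVβ₁; letI := θ.instVβ₂; letI := θ.instιβ; ∀ (a : θ.ιβ) (μ : Fin (F.P (Summit.QuantumFields.YangMills.Theorems.K0RecordFormatNames.recordK₀ F Mc k + n)).d) (y : Literature.MathematicalPhysics.QuantumFieldTheory.Balaban1983to89.Site (F.P (Summit.QuantumFields.YangMills.Theorems.K0RecordFormatNames.recordK₀ F Mc k + n)) (k + 1)), ∀ R3 R0 : ℕ, R3 + Summit.QuantumFields.YangMills.Theorems.K0RecordFormatNames.nestRadius Mc 1 ≤ R0 → 2 * (R0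 + 1) < (F.P (Summit.QuantumFields.YangMills.Theorems.K0RecordFormatNames.recordK₀ F Mc k + n)).sitesPerDir (k + 1) → ∀ z₀ : Fin 4 → ℤ, y ∈ Summit.QuantumFields.YangMills.Theorems.K0RecordFormatNames.recordWindow F k (Summit.QuantumFields.YangMills.Theorems.K0RecordFormatNames.recordK₀ F Mc k + n) R3 z₀ → letI Hd : Literature.MathematicalPhysics.QuantumFieldTheory.Balaban1983to89.PBond (F.P (Summit.QuantumFields.YangMills.Theorems.K0RecordFormatNames.recordK₀ F Mc k + n)) 0 → Fin 2 → Fin 2 → ℂ := fun b' => Summit.QuantumFields.YangMills.Theorems.K0RecordFormatNames.recordHrLocξ F θ k (Summit.QuantumFields.YangMills.Theorems.K0RecordFormatNames.recordK₀ F Mc k + n) Finset.univ a (μ, y) b' - Summit.QuantumFields.YangMills.Theorems.K0RecordFormatNames.recordHrLocξ F θ k (Summit.QuantumFields.YangMills.Theorems.K0RecordFormatNames.recordK₀ F Mc k + n) (Summit.QuantumFields.YangMills.Theorems.K0RecordFormatNames.recordWindow F k (Summit.QuantumFields.YangMills.Theorems.K0RecordFormatNames.recordK₀ F Mc k + n)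 R0 z₀) a (μ, y) b'; ∀ b : Literature.MathematicalPhysics.QuantumFieldTheory.Balaban1983to89.PBond (F.P (Summit.QuantumFields.YangMills.Theorems.K0RecordFormatNames.recordK₀ F Mc k + n)) 0, Summit.QuantumFields.YangMills.Theorems.K0RecordFormatNames.coarsenTo (k + 1) b.src ∈ Summit.QuantumFields.YangMills.Theorems.K0RecordFormatNames.recordWindow F k (Summit.QuantumFields.YangMills.Theorems.K0RecordFormatNames.recordK₀ F Mc k + n) R3 z₀ → ‖Hd b‖ ≤ C₉' * (F.P (Summit.QuantumFields.YangMills.Theorems.K0RecordFormatNames.recordK₀ F Mc k + n)).eta (k + 1) * Real.exp (-(δ₉ * ((R0 : ℝ) - (R3 : ℝ)))) ∧ (∀ ν : Fin (F.P (Summit.QuantumFields.YangMills.Theorems.K0RecordFormatNames.recordK₀ F Mc k + n)).d, ‖Hd (⟨b.src.shift ν, b.dir⟩ : Literature.MathematicalPhysics.QuantumFieldTheory.Balaban1983to89.PBond (F.P (Summit.QuantumFields.YangMills.Theorems.K0RecordFormatNames.recordK₀ F Mc k + n)) 0) - Hd b‖ ≤ C₉' * (F.P (Summit.QuantumFields.YangMills.Theorems.K0RecordFormatNames.recordK₀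 F Mc k + n)).eta (k + 1) ^ 2 * Real.exp (-(δ₉ * ((R0 : ℝ) - (R3 : ℝ))))) ∧ ‖∑ ν : Fin (F.P (Summit.QuantumFields.YangMills.Theorems.K0RecordFormatNames.recordK₀ F Mc k + n)).d, (Hd (⟨b.src.shift ν, b.dir⟩ : Literature.MathematicalPhysics.QuantumFieldTheory.Balaban1983to89.PBond (F.P (Summit.QuantumFields.YangMills.Theorems.K0RecordFormatNames.recordK₀ F Mc k + n)) 0) - (2 : ℂ) • Hd b + Hd (⟨b.src.unshift ν, b.dir⟩ : Literature.MathematicalPhysics.QuantumFieldTheory.Balaban1983to89.PBond (F.P (Summit.QuantumFields.YangMills.Theorems.K0RecordFormatNames.recordK₀ F Mc k + n)) 0))‖ ≤ C₉' * (F.P (Summit.QuantumFields.YangMills.Theorems.K0RecordFormatNames.recordK₀ F Mc k + n)).eta (k + 1) ^ 3 * Real.exp (-(δ₉ * ((R0 : ℝ) - (R3 : ℝ)))) ∧ ‖∑ ν : Fin (F.P (Summit.QuantumFields.YangMills.Theorems.K0RecordFormatNames.recordK₀ F Mc k + n)).d, ((Hd (⟨b.src, b.dir⟩ : Literature.MathematicalPhysics.QuantumFieldTheory.Balaban1983to89.PBond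 (F.P (Summit.QuantumFields.YangMills.Theorems.K0RecordFormatNames.recordK₀ F Mc k + n)) 0) + Hd (⟨(b.src).shift b.dir, ν⟩ : Literature.MathematicalPhysics.QuantumFieldTheory.Balaban1983to89.PBond (F.P (Summit.QuantumFields.YangMills.Theorems.K0RecordFormatNames.recordK₀ F Mc k + n)) 0) - Hd (⟨(b.src).shift ν, b.dir⟩ : Literature.MathematicalPhysics.QuantumFieldTheory.Balaban1983to89.PBond (F.P (Summit.QuantumFields.YangMills.Theorems.K0RecordFormatNames.recordK₀ F Mc k + n)) 0) - Hd (⟨b.src, ν⟩ : Literature.MathematicalPhysics.QuantumFieldTheory.Balaban1983to89.PBond (F.P (Summit.QuantumFields.YangMills.Theorems.K0RecordFormatNames.recordK₀ F Mc k + n)) 0)) - (Hd (⟨b.src.unshift ν, b.dir⟩ : Literature.MathematicalPhysics.QuantumFieldTheory.Balaban1983to89.PBond (F.P (Summit.QuantumFields.YangMills.Theorems.K0RecordFormatNames.recordK₀ F Mc k + n)) 0) + Hd (⟨(b.src.unshift ν).shift b.dir, ν⟩ : Literature.MathematicalPhysics.QuantumFieldTheory.Balaban1983to89.PBond (F.P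 (Summit.QuantumFields.YangMills.Theorems.K0RecordFormatNames.recordK₀ F Mc k + n)) 0) - Hd (⟨(b.src.unshift ν).shift ν, b.dir⟩ : Literature.MathematicalPhysics.QuantumFieldTheory.Balaban1983to89.PBond (F.P (Summit.QuantumFields.YangMills.Theorems.K0RecordFormatNames.recordK₀ F Mc k + n)) 0) - Hd (⟨b.src.unshift ν, ν⟩ : Literature.MathematicalPhysics.QuantumFieldTheory.Balaban1983to89.PBond (F.P (Summit.QuantumFields.YangMills.Theorems.K0RecordFormatNames.recordK₀ F Mc k + n)) 0)))‖ ≤ C₉' * (F.P (Summit.QuantumFields.YangMills.Theorems.K0RecordFormatNames.recordK₀ F Mc k + n)).eta (k + 1) ^ 3 * Real.exp (-(δ₉ * ((R0 : ℝ) - (R3 : ℝ))))))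

/-- RECEIPT: the pair splits into its two named tokens (kernel `Iff.rfl`) — the K0 consumer reads Tok-182 and Tok-cmpU-cap BY NAME. [cite: Balaban1985Variational, (182) p.307; Balaban1987RG1, (4.35) p.290] -/
theorem tokRest4_iff (F : T4Family) (Mc : ℕ) (a₀ : ℝ) :
    TokRest4 F Mc a₀ ↔ Tok182 F Mc a₀ ∧ TokCmpUcap F Mc a₀ := Iff.rfl

/-- ◆ CRIT-1's **v11-G₄ text `Sig7V11G4 F`** of stmt-QuantumFields-27931 (bca3cb0d9af367ce · 15 736 ch, ★★★ №498) VERBATIM after its leading family binder: v9-L with the third token block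
`((‴) ∧ ((Tok-182) ∧ (Tok-cmpU-cap)))`, consequent (C1)(C2a)(C2b) VERBATIM.  `∀ F, Sig7V11G4 F` will be the route decl `Theses.BalabanUVNodes.PortPieceLocalityU8` by `Iff.rfl` once G₄ is
signed and rendered — deliberately NOT stated here (O-8).  A HYPOTHESIS TEXT of an OPEN item; nothing asserted.
[cite: Balaban1985Variational, Prop. 9 p.309, (190) p.308, (182) p.307, (21) p.281; Balaban1987RG1, (1.7) p.261, (1.21) p.264, (4.35) p.290] -/
def Sig7V11G4 (F : T4Family) : Prop :=
  ∀ (Mc : ℕ) (j c c₀ c₁ : ℕ) (B₃ B₃' a₀ a₁ : ℝ), Summit.QuantumFields.YangMills.Theorems.K0RecordFormatNames.McGuard F Mc → c ≤ F.L ^ j → c₀ ≤ j + 1 → c₁ ≤ j → 2 * (F.L : ℝ) ^ 2 ≤ B₃ → 0 < B₃' → 0 < a₀ → 0 < a₁ → Literature.MathematicalPhysics.QuantumFieldTheory.Balaban1983to89.Node00.VariationalThm1RegSepCoP7MGB F 2 (fun ν M g K k _s => c ≤ ν.M₁ ∧ k + c₀ ≤ F.m + K ∧ F.L ^ c₁ ∣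 M ∧ ∀ i, 1 ≤ i → i ≤ k → Literature.MathematicalPhysics.QuantumFieldTheory.Balaban1983to89.Node00.dCubeSide (F.P K).L M (Literature.MathematicalPhysics.QuantumFieldTheory.Balaban1983to89.Node00.RkOfRecord (F.P K).L ν.r (g i)) i ∣ (F.P K).sitesPerDir 0) (Literature.MathematicalPhysics.QuantumFieldTheory.Balaban1983to89.Node00.lamDatum F) (Literature.MathematicalPhysics.QuantumFieldTheory.Balaban1983to89.Node00.dataSmall7LamTopOf F 2) B₃ a₀ a₁ → Literature.MathematicalPhysics.QuantumFieldTheory.Balaban1983to89.Node00.Gauge9RegSepTopStepGB F 2 (fun ν K Ω => Literature.MathematicalPhysics.QuantumFieldTheory.Balaban1983to89.Node00.suppDomOfRecord F ν K Ω) (F.L ^ j) (fun ν M g K k _s => c ≤ ν.M₁ ∧ k + c₀ ≤ F.m + K ∧ F.L ^ c₁ ∣ M ∧ ∀ i, 1 ≤ i → i ≤ k → Literature.MathematicalPhysics.QuantumFieldTheory.Balaban1983to89.Node00.dCubeSide (F.P K).L M (Literature.MathematicalPhysics.QuantumFieldTheory.Balaban1983to89.Node00.RkOfRecord (F.P K).L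 ν.r (g i)) i ∣ (F.P K).sitesPerDir 0) (Literature.MathematicalPhysics.QuantumFieldTheory.Balaban1983to89.Node00.lamDatum F) (Literature.MathematicalPhysics.QuantumFieldTheory.Balaban1983to89.Node00.dataSmall7LamTopOf F 2) B₃ B₃' a₀ a₁ → (∀ ε₁ : ℝ, 0 < ε₁ → ε₁ ≤ a₁ → B₃ * ε₁ ≤ a₀ → ∀ (k n : ℕ) (V : Literature.MathematicalPhysics.QuantumFieldTheory.Balaban1983to89.GaugeField (F.P (Summit.QuantumFields.YangMills.Theorems.K0RecordFormatNames.recordK₀ F Mc k + n)) (k + 1) (Literature.MathematicalPhysics.QuantumFieldTheory.Balaban1983to89.Node00.SU 2)), Literature.MathematicalPhysics.QuantumFieldTheory.Balaban1983to89.PlaqSmall ε₁ V → Literature.MathematicalPhysics.QuantumFieldTheory.Balaban1983to89.Node00.UkExists F 2 (Summit.QuantumFields.YangMills.Theorems.K0RecordFormatNames.recordK₀ F Mc k + n) (k + 1) a₀ V ∧ Literature.MathematicalPhysics.QuantumFieldTheory.Balaban1983to89.Node00.UniqueUkOrbit F 2 (Summit.QuantumFields.YangMills.Theorems.K0RecordFormatNames.recordK₀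 F Mc k + n) (k + 1) a₀ V) → (∀ (k n : ℕ) (ε₂₉ : ℝ), 0 < ε₂₉ → letI θ := Summit.QuantumFields.YangMills.Theorems.K0RecordFormatNames.thetaFill F a₀ ε₂₉; letI := θ.instVβ₁; letI := θ.instVβ₂; letI := θ.instιβ; AnalyticAt ℝ (fun B : Summit.QuantumFields.YangMills.Theorems.K0RecordFormatNames.recordW F a₀ ε₂₉ k (Summit.QuantumFields.YangMills.Theorems.K0RecordFormatNames.recordK₀ F Mc k + n) => fun (b : Literature.MathematicalPhysics.QuantumFieldTheory.Balaban1983to89.PBond (F.P (Summit.QuantumFields.YangMills.Theorems.K0RecordFormatNames.recordK₀ F Mc k + n)) 0) (i i' : Fin 2) => ((Summit.QuantumFields.YangMills.Theorems.K0RecordFormatNames.recordBgField F θ k (Summit.QuantumFields.YangMills.Theorems.K0RecordFormatNames.recordK₀ F Mc k + n) B b : Literature.MathematicalPhysics.QuantumFieldTheory.Balaban1983to89.Node00.SU 2) : Matrix (Fin 2) (Fin 2) ℂ) i i') 0) → ((∃ C₉' δ₉ : ℝ, 0 ≤ C₉' ∧ 0 < δ₉ ∧ ∀ (k n : ℕ)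 (ε₂₉ : ℝ), 0 < ε₂₉ → letI θ := Summit.QuantumFields.YangMills.Theorems.K0RecordFormatNames.thetaFill F a₀ ε₂₉; letI := θ.instVβ₁; letI := θ.instVβ₂; letI := θ.instιβ; ∀ (a : θ.ιβ) (μ : Fin (F.P (Summit.QuantumFields.YangMills.Theorems.K0RecordFormatNames.recordK₀ F Mc k + n)).d) (y : Literature.MathematicalPhysics.QuantumFieldTheory.Balaban1983to89.Site (F.P (Summit.QuantumFields.YangMills.Theorems.K0RecordFormatNames.recordK₀ F Mc k + n)) (k + 1)), letI Hr : Literature.MathematicalPhysics.QuantumFieldTheory.Balaban1983to89.PBond (F.P (Summit.QuantumFields.YangMills.Theorems.K0RecordFormatNames.recordK₀ F Mc k + n)) 0 → Fin 2 → Fin 2 → ℂ := fun b' => Summit.QuantumFields.YangMills.Theorems.K0RecordFormatNames.recordHr F θ k (Summit.QuantumFields.YangMills.Theorems.K0RecordFormatNames.recordK₀ F Mc k + n) a (μ, y) b'; ∀ b : Literature.MathematicalPhysics.QuantumFieldTheory.Balaban1983to89.PBond (F.P (Summit.QuantumFields.YangMills.Theorems.K0RecordFormatNames.recordK₀ F Mc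 k + n)) 0, ‖Hr b‖ ≤ C₉' * (F.P (Summit.QuantumFields.YangMills.Theorems.K0RecordFormatNames.recordK₀ F Mc k + n)).eta (k + 1) * Real.exp (-(δ₉ * (Literature.MathematicalPhysics.QuantumFieldTheory.Balaban1983to89.Site.tdist (Summit.QuantumFields.YangMills.Theorems.K0RecordFormatNames.coarsenTo (k + 1) b.src) y : ℝ))) ∧ (∀ ν : Fin (F.P (Summit.QuantumFields.YangMills.Theorems.K0RecordFormatNames.recordK₀ F Mc k + n)).d, ‖Hr (⟨b.src.shift ν, b.dir⟩ : Literature.MathematicalPhysics.QuantumFieldTheory.Balaban1983to89.PBond (F.P (Summit.QuantumFields.YangMills.Theorems.K0RecordFormatNames.recordK₀ F Mc k + n)) 0) - Hr b‖ ≤ C₉' * (F.P (Summit.QuantumFields.YangMills.Theorems.K0RecordFormatNames.recordK₀ F Mc k + n)).eta (k + 1) ^ 2 * Real.exp (-(δ₉ * (Literature.MathematicalPhysics.QuantumFieldTheory.Balaban1983to89.Site.tdist (Summit.QuantumFields.YangMills.Theorems.K0RecordFormatNames.coarsenTo (k + 1) b.src) y : ℝ)))) ∧ ‖∑ ν : Fin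 (F.P (Summit.QuantumFields.YangMills.Theorems.K0RecordFormatNames.recordK₀ F Mc k + n)).d, (Hr (⟨b.src.shift ν, b.dir⟩ : Literature.MathematicalPhysics.QuantumFieldTheory.Balaban1983to89.PBond (F.P (Summit.QuantumFields.YangMills.Theorems.K0RecordFormatNames.recordK₀ F Mc k + n)) 0) - (2 : ℂ) • Hr b + Hr (⟨b.src.unshift ν, b.dir⟩ : Literature.MathematicalPhysics.QuantumFieldTheory.Balaban1983to89.PBond (F.P (Summit.QuantumFields.YangMills.Theorems.K0RecordFormatNames.recordK₀ F Mc k + n)) 0))‖ ≤ C₉' * (F.P (Summit.QuantumFields.YangMills.Theorems.K0RecordFormatNames.recordK₀ F Mc k + n)).eta (k + 1) ^ 3 * Real.exp (-(δ₉ * (Literature.MathematicalPhysics.QuantumFieldTheory.Balaban1983to89.Site.tdist (Summit.QuantumFields.YangMills.Theorems.K0RecordFormatNames.coarsenTo (k + 1) b.src) y : ℝ))) ∧ ‖∑ ν : Fin (F.P (Summit.QuantumFields.YangMills.Theorems.K0RecordFormatNames.recordK₀ F Mc k + n)).d, ((Hr (⟨b.src, b.dir⟩ : Literature.MathematicalPhysics.QuantumFieldTheory.Balaban1983to89.PBond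 (F.P (Summit.QuantumFields.YangMills.Theorems.K0RecordFormatNames.recordK₀ F Mc k + n)) 0) + Hr (⟨(b.src).shift b.dir, ν⟩ : Literature.MathematicalPhysics.QuantumFieldTheory.Balaban1983to89.PBond (F.P (Summit.QuantumFields.YangMills.Theorems.K0RecordFormatNames.recordK₀ F Mc k + n)) 0) - Hr (⟨(b.src).shift ν, b.dir⟩ : Literature.MathematicalPhysics.QuantumFieldTheory.Balaban1983to89.PBond (F.P (Summit.QuantumFields.YangMills.Theorems.K0RecordFormatNames.recordK₀ F Mc k + n)) 0) - Hr (⟨b.src, ν⟩ : Literature.MathematicalPhysics.QuantumFieldTheory.Balaban1983to89.PBond (F.P (Summit.QuantumFields.YangMills.Theorems.K0RecordFormatNames.recordK₀ F Mc k + n)) 0)) - (Hr (⟨b.src.unshift ν, b.dir⟩ : Literature.MathematicalPhysics.QuantumFieldTheory.Balaban1983to89.PBond (F.P (Summit.QuantumFields.YangMills.Theorems.K0RecordFormatNames.recordK₀ F Mc k + n)) 0) + Hr (⟨(b.src.unshift ν).shift b.dir, ν⟩ : Literature.MathematicalPhysics.QuantumFieldTheory.Balaban1983to89.PBond (F.P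 (Summit.QuantumFields.YangMills.Theorems.K0RecordFormatNames.recordK₀ F Mc k + n)) 0) - Hr (⟨(b.src.unshift ν).shift ν, b.dir⟩ : Literature.MathematicalPhysics.QuantumFieldTheory.Balaban1983to89.PBond (F.P (Summit.QuantumFields.YangMills.Theorems.K0RecordFormatNames.recordK₀ F Mc k + n)) 0) - Hr (⟨b.src.unshift ν, ν⟩ : Literature.MathematicalPhysics.QuantumFieldTheory.Balaban1983to89.PBond (F.P (Summit.QuantumFields.YangMills.Theorems.K0RecordFormatNames.recordK₀ F Mc k + n)) 0)))‖ ≤ C₉' * (F.P (Summit.QuantumFields.YangMills.Theorems.K0RecordFormatNames.recordK₀ F Mc k + n)).eta (k + 1) ^ 3 * Real.exp (-(δ₉ * (Literature.MathematicalPhysics.QuantumFieldTheory.Balaban1983to89.Site.tdist (Summit.QuantumFields.YangMills.Theorems.K0RecordFormatNames.coarsenTo (k + 1) b.src) y : ℝ)))) ∧ (∀ (k n : ℕ) (ε₂₉ : ℝ), 0 < ε₂₉ → letI θ := Summit.QuantumFields.YangMills.Theorems.K0RecordFormatNames.thetaFill F a₀ ε₂₉; letI := θ.instVβ₁; letI :=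 θ.instVβ₂; letI := θ.instιβ; ∀ (a : θ.ιβ) (μ : Fin (F.P (Summit.QuantumFields.YangMills.Theorems.K0RecordFormatNames.recordK₀ F Mc k + n)).d) (y : Literature.MathematicalPhysics.QuantumFieldTheory.Balaban1983to89.Site (F.P (Summit.QuantumFields.YangMills.Theorems.K0RecordFormatNames.recordK₀ F Mc k + n)) (k + 1)), ∀ b : Literature.MathematicalPhysics.QuantumFieldTheory.Balaban1983to89.PBond (F.P (Summit.QuantumFields.YangMills.Theorems.K0RecordFormatNames.recordK₀ F Mc k + n)) 0, Summit.QuantumFields.YangMills.Theorems.K0RecordFormatNames.recordHr F θ k (Summit.QuantumFields.YangMills.Theorems.K0RecordFormatNames.recordK₀ F Mc k + n) a (μ, y) b = Summit.QuantumFields.YangMills.Theorems.K0RecordFormatNames.recordHrLocξ F θ k (Summit.QuantumFields.YangMills.Theorems.K0RecordFormatNames.recordK₀ F Mc k + n) Finset.univ a (μ, y) b) ∧ ((∃ C₉' δ₉ : ℝ, 0 ≤ C₉' ∧ 0 < δ₉ ∧ ∀ (k n : ℕ) (ε₂₉ : ℝ), 0 < ε₂₉ → letI θ := Summit.QuantumFields.YangMills.Theorems.K0RecordFormatNames.thetaFill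 F a₀ ε₂₉; letI := θ.instVβ₁; letI := θ.instVβ₂; letI := θ.instιβ; ∀ (a : θ.ιβ) (μ : Fin (F.P (Summit.QuantumFields.YangMills.Theorems.K0RecordFormatNames.recordK₀ F Mc k + n)).d) (y : Literature.MathematicalPhysics.QuantumFieldTheory.Balaban1983to89.Site (F.P (Summit.QuantumFields.YangMills.Theorems.K0RecordFormatNames.recordK₀ F Mc k + n)) (k + 1)), ∀ R3 R0 : ℕ, R3 + Summit.QuantumFields.YangMills.Theorems.K0RecordFormatNames.nestRadius Mc 1 ≤ R0 → 2 * (R0 + 1) < (F.P (Summit.QuantumFields.YangMills.Theorems.K0RecordFormatNames.recordK₀ F Mc k + n)).sitesPerDir (k + 1) → ∀ z₀ : Fin 4 → ℤ, y ∈ Summit.QuantumFields.YangMills.Theorems.K0RecordFormatNames.recordWindow F k (Summit.QuantumFields.YangMills.Theorems.K0RecordFormatNames.recordK₀ F Mc k + n) R3 z₀ → letI Hd : Literature.MathematicalPhysics.QuantumFieldTheory.Balaban1983to89.PBond (F.P (Summit.QuantumFields.YangMills.Theorems.K0RecordFormatNames.recordK₀ F Mc k + n)) 0 → Fin 2 →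 Fin 2 → ℂ := fun b' => Summit.QuantumFields.YangMills.Theorems.K0RecordFormatNames.recordHrLocξ F θ k (Summit.QuantumFields.YangMills.Theorems.K0RecordFormatNames.recordK₀ F Mc k + n) Finset.univ a (μ, y) b' - Summit.QuantumFields.YangMills.Theorems.K0RecordFormatNames.recordHrLocξ F θ k (Summit.QuantumFields.YangMills.Theorems.K0RecordFormatNames.recordK₀ F Mc k + n) (Summit.QuantumFields.YangMills.Theorems.K0RecordFormatNames.recordWindow F k (Summit.QuantumFields.YangMills.Theorems.K0RecordFormatNames.recordK₀ F Mc k + n) R0 z₀) a (μ, y) b'; ∀ b : Literature.MathematicalPhysics.QuantumFieldTheory.Balaban1983to89.PBond (F.P (Summit.QuantumFields.YangMills.Theorems.K0RecordFormatNames.recordK₀ F Mc k + n)) 0, Summit.QuantumFields.YangMills.Theorems.K0RecordFormatNames.coarsenTo (k + 1) b.src ∈ Summit.QuantumFields.YangMills.Theorems.K0RecordFormatNames.recordWindow F k (Summit.QuantumFields.YangMills.Theorems.K0RecordFormatNames.recordK₀ F Mc k + n) R3 z₀ → ‖Hd b‖ ≤ C₉' * (F.P (Summit.QuantumFields.YangMills.Theorems.K0RecordFormatNames.recordK₀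 F Mc k + n)).eta (k + 1) * Real.exp (-(δ₉ * ((R0 : ℝ) - (R3 : ℝ)))) ∧ (∀ ν : Fin (F.P (Summit.QuantumFields.YangMills.Theorems.K0RecordFormatNames.recordK₀ F Mc k + n)).d, ‖Hd (⟨b.src.shift ν, b.dir⟩ : Literature.MathematicalPhysics.QuantumFieldTheory.Balaban1983to89.PBond (F.P (Summit.QuantumFields.YangMills.Theorems.K0RecordFormatNames.recordK₀ F Mc k + n)) 0) - Hd b‖ ≤ C₉' * (F.P (Summit.QuantumFields.YangMills.Theorems.K0RecordFormatNames.recordK₀ F Mc k + n)).eta (k + 1) ^ 2 * Real.exp (-(δ₉ * ((R0 : ℝ) - (R3 : ℝ))))) ∧ ‖∑ ν : Fin (F.P (Summit.QuantumFields.YangMills.Theorems.K0RecordFormatNames.recordK₀ F Mc k + n)).d, (Hd (⟨b.src.shift ν, b.dir⟩ : Literature.MathematicalPhysics.QuantumFieldTheory.Balaban1983to89.PBond (F.P (Summit.QuantumFields.YangMills.Theorems.K0RecordFormatNames.recordK₀ F Mc k + n)) 0) - (2 : ℂ) • Hd b + Hd (⟨b.src.unshift ν, b.dir⟩ : Literature.MathematicalPhysics.QuantumFieldTheory.Balaban1983to89.PBond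 (F.P (Summit.QuantumFields.YangMills.Theorems.K0RecordFormatNames.recordK₀ F Mc k + n)) 0))‖ ≤ C₉' * (F.P (Summit.QuantumFields.YangMills.Theorems.K0RecordFormatNames.recordK₀ F Mc k + n)).eta (k + 1) ^ 3 * Real.exp (-(δ₉ * ((R0 : ℝ) - (R3 : ℝ)))) ∧ ‖∑ ν : Fin (F.P (Summit.QuantumFields.YangMills.Theorems.K0RecordFormatNames.recordK₀ F Mc k + n)).d, ((Hd (⟨b.src, b.dir⟩ : Literature.MathematicalPhysics.QuantumFieldTheory.Balaban1983to89.PBond (F.P (Summit.QuantumFields.YangMills.Theorems.K0RecordFormatNames.recordK₀ F Mc k + n)) 0) + Hd (⟨(b.src).shift b.dir, ν⟩ : Literature.MathematicalPhysics.QuantumFieldTheory.Balaban1983to89.PBond (F.P (Summit.QuantumFields.YangMills.Theorems.K0RecordFormatNames.recordK₀ F Mc k + n)) 0) - Hd (⟨(b.src).shift ν, b.dir⟩ : Literature.MathematicalPhysics.QuantumFieldTheory.Balaban1983to89.PBond (F.P (Summit.QuantumFields.YangMills.Theorems.K0RecordFormatNames.recordK₀ F Mc k + n)) 0) - Hd (⟨b.src,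 ν⟩ : Literature.MathematicalPhysics.QuantumFieldTheory.Balaban1983to89.PBond (F.P (Summit.QuantumFields.YangMills.Theorems.K0RecordFormatNames.recordK₀ F Mc k + n)) 0)) - (Hd (⟨b.src.unshift ν, b.dir⟩ : Literature.MathematicalPhysics.QuantumFieldTheory.Balaban1983to89.PBond (F.P (Summit.QuantumFields.YangMills.Theorems.K0RecordFormatNames.recordK₀ F Mc k + n)) 0) + Hd (⟨(b.src.unshift ν).shift b.dir, ν⟩ : Literature.MathematicalPhysics.QuantumFieldTheory.Balaban1983to89.PBond (F.P (Summit.QuantumFields.YangMills.Theorems.K0RecordFormatNames.recordK₀ F Mc k + n)) 0) - Hd (⟨(b.src.unshift ν).shift ν, b.dir⟩ : Literature.MathematicalPhysics.QuantumFieldTheory.Balaban1983to89.PBond (F.P (Summit.QuantumFields.YangMills.Theorems.K0RecordFormatNames.recordK₀ F Mc k + n)) 0) - Hd (⟨b.src.unshift ν, ν⟩ : Literature.MathematicalPhysics.QuantumFieldTheory.Balaban1983to89.PBond (F.P (Summit.QuantumFields.YangMills.Theorems.K0RecordFormatNames.recordK₀ F Mc k + n)) 0)))‖ ≤ C₉'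 * (F.P (Summit.QuantumFields.YangMills.Theorems.K0RecordFormatNames.recordK₀ F Mc k + n)).eta (k + 1) ^ 3 * Real.exp (-(δ₉ * ((R0 : ℝ) - (R3 : ℝ))))))) → ∀ α₂ : ℝ, 0 < α₂ → ∃ C₉ δ₀ : ℝ, 0 ≤ C₉ ∧ 0 < δ₀ ∧ ∀ k : ℕ, ∀ ε₂₉ : ℝ, 0 < ε₂₉ → (∀ a : (Summit.QuantumFields.YangMills.Theorems.K0RecordFormatNames.thetaFill F a₀ ε₂₉).ιβ, Literature.MathematicalPhysics.QuantumFieldTheory.Balaban1983to89.B12FormatPlus.Response9D (Summit.QuantumFields.YangMills.Theorems.K0RecordFormatNames.recordResponse9DataFromL F (Summit.QuantumFields.YangMills.Theorems.K0RecordFormatNames.thetaFill F a₀ ε₂₉) a Mc k (Summit.QuantumFields.YangMills.Theorems.K0RecordFormatNames.recordK₀ F Mc k)) (fun n => Summit.QuantumFields.YangMills.Theorems.K0RecordFormatNames.recordChartJ F Mc k (Summit.QuantumFields.YangMills.Theorems.K0RecordFormatNames.recordK₀ F Mc k + n)) (fun n => Summit.QuantumFields.YangMills.Theorems.K0RecordFormatNames.recordRNat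 F Mc k (Summit.QuantumFields.YangMills.Theorems.K0RecordFormatNames.recordK₀ F Mc k + n)) (fun n X => Summit.QuantumFields.YangMills.Theorems.K0RecordFormatNames.recordDom44J F Mc k (Summit.QuantumFields.YangMills.Theorems.K0RecordFormatNames.recordK₀ F Mc k + n) X α₂) C₉ δ₀) ∧ ∀ n : ℕ, letI θ := Summit.QuantumFields.YangMills.Theorems.K0RecordFormatNames.thetaFill F a₀ ε₂₉; letI := θ.instVβ₁; letI := θ.instVβ₂; ContDiffAt ℝ 2 (Summit.QuantumFields.YangMills.Theorems.K0RecordFormatNames.recordEmbJ F θ k (Summit.QuantumFields.YangMills.Theorems.K0RecordFormatNames.recordK₀ F Mc k + n)) 0 ∧ Summit.QuantumFields.YangMills.Theorems.K0RecordFormatNames.recordEmbJ F θ k (Summit.QuantumFields.YangMills.Theorems.K0RecordFormatNames.recordK₀ F Mc k + n) 0 = 0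

/-- **`JoinGoalL11G4 F` — `JoinGoalL′` OF RECORD for the G₄ wording**: `JoinGoalWith` at `Tok := TokP9L4‴ ∧ TokRest4` (the K0 consumer's stub-2″ antecedent shape over G₄'s hypothesis list).
A SHAPE; nothing asserted. [cite: Balaban1987RG1, Thm 1 p.259, (1.19)–(1.22) pp.263–264, (4.35) p.290, (5.10) p.293] -/
def JoinGoalL11G4 (F : T4Family) : Prop :=
  JoinGoalWith (fun F Mc a₀ => TokP9L4New F Mc a₀ ∧ TokRest4 F Mc a₀) F

/-- **J3′ (a)**: the G₄ text projects onto the frozen consumer interface at `Tok := ‴ ∧ TokRest4` (drop (C2a)(C2b); the inlined third block elaborates against the names by δ).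
[cite: Balaban1985Variational, Prop. 9 p.309; Balaban1987RG1, (4.35) p.290] -/
theorem sig7With_of_sig7V11G4 (F : T4Family) (h7 : Sig7V11G4 F) :
    Sig7With (fun F Mc a₀ => TokP9L4New F Mc a₀ ∧ TokRest4 F Mc a₀) F := by
  intro Mc j c c₀ c₁ B₃ B₃' a₀ a₁ hG0 hc hc₀ hc₁ hB₃ hB₃' ha₀ ha₁ hThm hGauge hUk hBg hP9 α₂ hα₂
  obtain ⟨C₉, δ₀, hC₉, hδ₀, h7k⟩ := h7 Mc j c c₀ c₁ B₃ B₃' a₀ a₁ hG0 hc hc₀ hc₁ hB₃ hB₃' ha₀ ha₁ hThm hGauge hUk hBg hP9 α₂ hα₂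
  exact ⟨C₉, δ₀, hC₉, hδ₀, fun k ε₂₉ hε => (h7k k ε₂₉ hε).1⟩

/-- ★★★★★★★★★★★ **№496 (ii) J3′ «CONSUMER INSTANCE COVER» ON v11-G₄, IN THE TREE's CURRENCY**: ⁸ (`Sig8LR4 F`, 27930 SIGNED 12934e3f) ∧ `Sig7V11G4 F` (bca3cb0d) ⟹ `JoinGoalL11G4 F` — every
(R1ᴰ)∕(R3)∕(R4ᴰ)∕(R5) instance the frozen consumer reads, for EVERY `X ∈ recordDomSys` incl. the wrap class, is supplied by G₄'s own GLOBAL consequent; ⁸'s 13th hypothesis by ‴ via ✓p802240.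
HONEST: an implication from two OPEN statement items (taken as hypotheses) to the JOIN goal; nothing of [I]∕[15] discharged; K0⁷∕K0ᴬ OPEN; NODE O 0∕1; the mass gap is NOT proved.
[cite: Balaban1987RG1, Thm 1 p.259, (1.19)–(1.22) pp.263–264, (4.35)–(4.37) p.290, (5.10) p.293; Balaban1985Variational, Prop. 9 p.309, (190) p.308, (182) p.307, (21) p.281] -/
theorem joinGoalL11G4_of_texts (F : T4Family) (h8 : Sig8LR4 F) (h7 : Sig7V11G4 F) : JoinGoalL11G4 F :=
  joinGoalWith_of_texts_conj TokRest4 F h8 (sig7With_of_sig7V11G4 F h7)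

/-- The same with both texts universally quantified (`∀ F` = the two route decls by `Iff.rfl` once G₄ is rendered; not stated here, O-8). [cite: Balaban1987RG1, Thm 1 p.259, (4.35) p.290] -/
theorem joinGoalL11G4_of_texts' (h8 : ∀ F, Sig8LR4 F) (h7 : ∀ F, Sig7V11G4 F) : ∀ F : T4Family, JoinGoalL11G4 F :=
  fun F => joinGoalL11G4_of_texts F (h8 F) (h7 F)

end Summit.QuantumFields.YangMills.Theorems.PortHRecordJoin

end
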